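import Literature.AlgebraicGeometry.Andre1996.WeilClassesAlgebraicallyAnchoredPencil
import HarnessLib

/-!
# Ring 2 / AbelianAll (André column) — the class target «WEIL CLASSES OF SPLIT `E`-WEIL STRUCTURES, EVERY CM FIELD `E`» in André's format
# (definition only)

research route, not a corollary; conditional on HC_CM plus one named minimal statement.

DEFINITION ONLY (nothing asserted, nothing proved; `HC_CM` absent). The Weil ladder names the split sectors for an IMAGINARY QUADRATIC field
(`WeilTypeLadder.SplitEightfolds`, `SplitWeilAbelianVarieties`: `φ² = -d`, the `K`-symmetrised hyperplane class `d·e^*a + φ^*e^*a` hyperbolic) and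
the whole CM-field sector (`WeilClassesCMField`, rung R3; on Deligne's carriers `Ring2.Hypotheses.WeilClassesWeilTypeCM`, `e₀ ≥ 2`), but has no name
for the sector André's Lemme 6.3.3 is about: Weil classes of Weil structures satisfying his condition `(*)` — SPLIT, relative to a CM field `E` of ANY
degree `2e₀ ≥ 2` — in the typing fixed by the literature seat's `Andre1996.andre1996_splitWeilClasses_algebraicallyAnchoredPencil`:
`Deligne1982.IsWeilTypeCM B η R e₀ p` (`E = ℚ(η) ≅ ℚ[T]/(R(T²))`, `dim_E H¹ = 2p`), an `E`-COMPATIBLE HYPERPLANE CLASS `h = e^*a` (`a ≠ 0` rational;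
Rosati = complex conjugation on `E`), `Motives.IsHyperbolicWeilType B η (p·e₀) h` («`φ` admettant un sous-espace totalement isotrope de dimension
`p`»), and the complexified `E`-line of Weil classes `weilClassesField B η (R(T²)) (2p)`. This file names that sector:

* `AndreSplitWeilClasses` (`@[conjecture]`): for every such datum, every RATIONAL class of `W_E ⊗ ℂ` is algebraic (the Hodge-type hypothesis is
  redundant — Weil classes of a Weil-type datum are of type `(p,p)`, Moonen–Zarhin's criterion, a theorem of the tree — and is omitted, exactly as in
  the literature seat's `…forall_rational_mem_algebraicClasses`).

In print: KNOWN for `p = 1` (Lefschetz) and for `p·e₀ ≤ 3` with `e₀ = 1` (split Weil sixfolds, Markman arXiv:2502.03415 Thm. 1.5.1, PREPRINT; fourfolds: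
Markman 2023 / van Geemen–Schoen); OPEN in every dimension `2p·e₀ ≥ 8` («dimension `≥ 8`: nothing for any `K`», §1.2; «`[K:ℚ] > 2`», arXiv:2509.23403
§12). A CASE of the summit and of `HC_AV` (companion rows file: ON-PATH lemmas); implied by the literature seat's fact + `InvariantCyclesHoldFor` on
compact abelian pencils, and — the point of PART AD — by the door + carriers for `E`-Weil classes at `E`-tensor points over ONE elliptic curve
(companion files). A HYPOTHESIS ∕ TARGET wherever used; nothing here says it holds.
References: [cite: Andre1996Motifs, §6.3 b) condition (*) (p. 32), Lemme 6.3.3 (p. 33)] [cite: Deligne1982HodgeCycles, §4 (4.4), Cor. 4.2, Lemma 4.6]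
[cite: MoonenZarhin1998WeilClasses, §1] [cite: Markman2025SecantWeil, §1.2 and Thm. 1.5.1] [cite: Markman2025SurveySecant, §12].
-/

noncomputable section

open CategoryTheory

namespace Summit.HodgeConjecture.HodgeConjecture.Ring2.AbelianAll

-- the cell's namespace repeats the summit name (`Summit.HodgeConjecture.HodgeConjecture…`), as in every `Ring2*` file
set_option linter.dupNamespace false

open Literature.AlgebraicGeometry Literature.AlgebraicGeometry.Motives
open Literature.AlgebraicGeometry.HodgeTheory
open Literature.AlgebraicGeometry.Deligne1982
open Literature.AlgebraicGeometry.VanGeemen1994 (pullbackOne)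
open Literature.AlgebraicTopology.SingularHomology

/-- **`AndreSplitWeilClasses` — the Weil classes of SPLIT `E`-Weil structures (André's condition `(*)`), EVERY CM field `E`, are algebraic (typed; a
CASE of the summit).** For every complex abelian variety `B` with `η : B ⟶ B` of Weil type relative to the CM field `E = ℚ(η) ≅ ℚ[T]/(R(T²))` of degree
`2e₀`, `dim_E H¹(B, ℚ) = 2p` (`IsWeilTypeCM B η R e₀ p`), every projective embedding `e` and rational `a ≠ 0` whose hyperplane class `h = e^*a` is
`E`-compatible (`Q_h(η^*x, y) = -Q_h(x, η^*y)`) and SPLIT (`IsHyperbolicWeilType B η (p·e₀) h`), every RATIONAL class of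
`W_E ⊗ ℂ = weilClassesField B η (R(T²)) (2p)` is algebraic. Hypotheses VERBATIM those of `Andre1996.andre1996_splitWeilClasses_algebraicallyAnchoredPencil`
(one datum). KNOWN in print for `p = 1` and for split sixfolds with `E` quadratic (preprint); OPEN for `2p·e₀ ≥ 8`. ON-PATH
`andreSplitWeilClasses_of_hodgeConjecture` (companion file). [cite: Andre1996Motifs, §6.3 b) (*) (p. 32) and Lemme 6.3.3 (p. 33)]
[cite: Deligne1982HodgeCycles, §4 (4.4), Cor. 4.2, Lemma 4.6] [cite: MoonenZarhin1998WeilClasses, §1] [cite: Markman2025SecantWeil, §1.2] [status: open] -/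
@[conjecture] def AndreSplitWeilClasses : Prop :=
  ∀ (B : AbelianVariety ℂ) (η : B ⟶ B) (R : Polynomial ℤ) (e₀ p : ℕ) (e : ProjectiveEmbedding B.X)
    (a : complexBetti (projectiveSpace e.n ℂ) 2),
    IsWeilTypeCM B η R e₀ p → IsRationalClass a → a ≠ 0 →
    (∀ x y : complexBetti B.X 1,
      polarizationPairingOne B.X (complexBetti.map e.ι 2 a) (B.dim - 1) (pullbackOne B η x) y =
        -polarizationPairingOne B.X (complexBetti.map e.ι 2 a) (B.dim - 1) x (pullbackOne B η y)) →
    IsHyperbolicWeilType B η (p * e₀) (complexBetti.map e.ι 2 a) →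
      ∀ w ∈ weilClassesField B η (R.comp (Polynomial.X ^ 2)) (2 * p), IsRationalClass w → w ∈ algebraicClasses B.X p

end Summit.HodgeConjecture.HodgeConjecture.Ring2.AbelianAll

end
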